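import Mathlib
import Literature.NumberTheory.Automorphic.HyperbolicLaplaceSpectrum
import Summits.Langlands.Langlands.Theses.QuarterDeficit1951

/-!
# Stub `stub_parityClosure` (S1): the parity closure of the crux's witness class

Crux stmt-Langlands-15897 `Summit.Langlands.Langlands.Theses.QuarterDeficit1951.QuarterFingerprintDeficit` (C1), line
`Sketch` (lead c2 parity reshape), registered stub `stub_parityClosure : ParityClosure` (S1) of the proof-direction
parity split `ParityClosure → DeficitOdd → DeficitEven → C1`. Content: if `u` satisfies the crux's `IsForm χ u λ`
(`C²`, `(Δ + λ) u = 0`, `Γ₀(1951)`-automorphic with nebentypus `χ(d)`, zero constant terms at `∞` and at `0`,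
bounded) then so do `u − u∘R` and `u + u∘R` (`R z = -z̄ = UpperHalfPlane.J • z`), with the same `T_p`-eigenvalues
(`p ≤ 13`). Ingredients (namespace `ParityClosureAux`): `R` is a real-linear isometry of `ℂ` preserving the
half-plane, so `C²` and the Euclidean Laplacian transport; `RγR = [[a,-b],[-c,d]] ∈ Γ₀(1951)` has the same `d`;
`R(x+iy) = -x+iy`, `R(S•w) = S•(Rw)` and the periods `1` (`T ∈ Γ₀(1951)`) and `1951` (`S T^{1951} = [[1,0],[-1951,1]] S`)
reflect the two constant-term integrals; continuity gives integrability, so the class is a linear space; `T_p` is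
linear and commutes with `R` (reindex `b ↦ p - b` using the period `1`). The defs `P₀`, `IsForm`, `Tp`,
`ParityClosure` are verbatim copies of the crux's inlined `let`s / of the skeleton's defs.
-/

set_option linter.dupNamespace false -- project-wide option (lakefile weak.linter.dupNamespace); `Summit.Langlands.Langlands` is the mandated namespace

noncomputable section

namespace Summit.Langlands.Langlands.Theorems.QuarterFingerprintDeficit

open scoped MatrixGroups ComplexConjugate
open UpperHalfPlane (J ofComplex)

/-- The six fingerprint primes (verbatim copy of the crux's `let P₀`). [folklore] -/
def P₀ : Finset ℕ := {2, 3, 5, 7, 11, 13}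

/-- The crux's witness class `IsForm χ u λ` (verbatim copy of the crux's `let IsForm`): `u` is `C²`,
`(Δ + λ) u = 0`, `Γ₀(1951)`-automorphic with nebentypus `χ(d)`, has zero constant terms at the cusps `∞`
(width `1`) and `0` (width `1951`), and is bounded. [folklore] -/
def IsForm (χ : DirichletCharacter ℂ 1951) (u : UpperHalfPlane → ℂ) (lam : ℝ) : Prop :=
  Literature.NumberTheory.Automorphic.IsC2 u ∧
  (∀ z, Literature.NumberTheory.Automorphic.hypLaplacian u z + (lam : ℂ) * u z = 0) ∧
  (∀ γ : Matrix.SpecialLinearGroup (Fin 2) ℤ, γ ∈ CongruenceSubgroup.Gamma0 1951 →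
    ∀ z : UpperHalfPlane, u (γ • z) = χ ((γ 1 1 : ℤ) : ZMod 1951) * u z) ∧
  (∀ y : ℝ, 0 < y → ∫ x in (0 : ℝ)..1, u (ofComplex (x + y * Complex.I)) = 0) ∧
  (∀ y : ℝ, 0 < y →
    ∫ x in (0 : ℝ)..1951, u (ModularGroup.S • ofComplex (x + y * Complex.I)) = 0) ∧
  (∃ C : ℝ, ∀ z, ‖u z‖ ≤ C)

/-- The crux's classical Hecke operator `T_p` (unitary normalisation, nebentypus `χ`; verbatim copy of the
crux's `let Tp`). [folklore] -/
def Tp (χ : DirichletCharacter ℂ 1951) (p : ℕ) (u : UpperHalfPlane → ℂ) (z : UpperHalfPlane) : ℂ :=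
  ((Real.sqrt p : ℝ) : ℂ)⁻¹ *
    ((∑ b ∈ Finset.range p, u (ofComplex (((z : ℂ) + b) / p))) +
      χ (p : ZMod 1951) * u (ofComplex ((p : ℂ) * z)))

/-- `ParityClosure` (verbatim copy of the skeleton's def; the registered stub's statement, proved below as
`stub_parityClosure` — a statement about the crux's own inlined objects, not a published fact): the witness class
`IsForm χ · λ` is closed under `u ↦ u − u∘R` and `u ↦ u + u∘R` (`R z = -z̄ = J • z`), and these have the same
`T_p`-eigenvalues as `u` at the six fingerprint primes. -/
def ParityClosure : Prop :=
  ∀ (χ : DirichletCharacter ℂ 1951) (u : UpperHalfPlane → ℂ) (lam : ℝ), IsForm χ u lam →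
    (IsForm χ (fun z => u z - u (J • z)) lam ∧ IsForm χ (fun z => u z + u (J • z)) lam) ∧
    ∀ p ∈ P₀, ∀ μ : ℂ, (∀ z, Tp χ p u z = μ * u z) →
      (∀ z, Tp χ p (fun w => u w - u (J • w)) z = μ * (u z - u (J • z))) ∧
      (∀ z, Tp χ p (fun w => u w + u (J • w)) z = μ * (u z + u (J • z)))

namespace ParityClosureAux

open UpperHalfPlane Laplacian Literature.NumberTheory.Automorphic
open scoped InnerProductSpace

/-- `R (ofComplex w) = ofComplex (-w̄)` on the open half-plane. [folklore] -/
theorem J_smul_ofComplex' (w : ℂ) (hw : 0 < w.im) : J • ofComplex w = ofComplex (-conj w) := by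
  have h2 : 0 < (-conj w).im := by simpa using hw
  apply UpperHalfPlane.ext
  rw [coe_J_smul, ofComplex_apply_of_im_pos hw, ofComplex_apply_of_im_pos h2, coe_mk, coe_mk]

/-- `R (x + iy) = -x + iy`. [folklore] -/
theorem J_smul_ofComplex (x y : ℝ) (hy : 0 < y) :
    J • ofComplex ((x : ℂ) + y * Complex.I) = ofComplex (((-x : ℝ) : ℂ) + y * Complex.I) := by
  have h1 : 0 < ((x : ℂ) + y * Complex.I).im := by simpa using hy
  rw [J_smul_ofComplex' _ h1]
  congr 1
  apply Complex.ext <;> simp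

/-- `T • ofComplex w = ofComplex (w + 1)` on the open half-plane. [folklore] -/
theorem T_smul_ofComplex' (w : ℂ) (hw : 0 < w.im) : ModularGroup.T • ofComplex w = ofComplex (w + 1) := by
  have h2 : 0 < (w + 1).im := by simpa using hw
  apply UpperHalfPlane.ext
  rw [modular_T_smul, coe_vadd, ofComplex_apply_of_im_pos hw, ofComplex_apply_of_im_pos h2, coe_mk, coe_mk]
  push_cast; ring

/-- `T ^ n • ofComplex (x + iy) = ofComplex ((x + n) + iy)`. [folklore] -/
theorem T_zpow_smul_ofComplex (n : ℤ) (x y : ℝ) (hy : 0 < y) :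
    ModularGroup.T ^ n • ofComplex ((x : ℂ) + y * Complex.I) = ofComplex (((x + n : ℝ) : ℂ) + y * Complex.I) := by
  have h1 : 0 < ((x : ℂ) + y * Complex.I).im := by simpa using hy
  have h2 : 0 < ((((x + n : ℝ)) : ℂ) + y * Complex.I).im := by simpa using hy
  apply UpperHalfPlane.ext
  rw [modular_T_zpow_smul, coe_vadd, ofComplex_apply_of_im_pos h1, ofComplex_apply_of_im_pos h2, coe_mk, coe_mk]
  push_cast; ring

/-- `R (S • w) = S • (R w)`. [folklore] -/
theorem J_smul_S_smul (w : ℍ) : J • (ModularGroup.S • w) = ModularGroup.S • (J • w) := by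
  symm; apply UpperHalfPlane.ext
  rw [coe_J_smul, modular_S_smul, modular_S_smul, coe_mk, coe_mk, coe_J_smul]
  simp [map_neg, map_inv₀]

/-- `R γ R = [[a,-b],[-c,d]]` as an element of `SL₂(ℤ)` (same `d`-entry as `γ`). [folklore] -/
def reflConj (γ : SL(2, ℤ)) : SL(2, ℤ) :=
  ⟨!![γ 0 0, -(γ 0 1); -(γ 1 0), γ 1 1], by
    have h := γ.det_coe
    rw [Matrix.det_fin_two] at h
    rw [Matrix.det_fin_two_of]
    linarith⟩

/-- `R Γ₀(N) R = Γ₀(N)`. [folklore] -/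
theorem reflConj_mem {N : ℕ} {γ : SL(2, ℤ)} (hγ : γ ∈ CongruenceSubgroup.Gamma0 N) :
    reflConj γ ∈ CongruenceSubgroup.Gamma0 N := by
  rw [CongruenceSubgroup.Gamma0_mem] at hγ ⊢
  simp [reflConj, hγ]

/-- `R (γ z) = (R γ R) (R z)`. [folklore] -/
theorem J_smul_sl_smul (γ : SL(2, ℤ)) (z : ℍ) : J • (γ • z) = reflConj γ • (J • z) := by
  apply UpperHalfPlane.ext
  rw [coe_J_smul, coe_specialLinearGroup_apply, coe_specialLinearGroup_apply, coe_J_smul]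
  simp only [reflConj, eq_intCast, Matrix.SpecialLinearGroup.coe_mk, Matrix.of_apply, Matrix.cons_val',
    Matrix.cons_val_zero, Matrix.cons_val_one, Matrix.cons_val_fin_one, Matrix.empty_val',
    map_div₀, map_add, map_mul, map_neg, Complex.conj_ofReal]
  rw [← neg_div]
  congr 1 <;> push_cast <;> ring

/-- `[[1,0],[-1951,1]] = S T^{1951} S⁻¹ ∈ Γ₀(1951)`, the generator of the stabiliser of the cusp `0`. [folklore] -/
def gamma1951 : SL(2, ℤ) := ⟨!![1, 0; -1951, 1], by norm_num [Matrix.det_fin_two_of]⟩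

/-- `S T^{1951} = [[1,0],[-1951,1]] S`. [folklore] -/
theorem S_mul_T_zpow : ModularGroup.S * ModularGroup.T ^ (1951 : ℤ) = gamma1951 * ModularGroup.S := by
  ext i j
  simp only [Matrix.SpecialLinearGroup.coe_mul, ModularGroup.coe_T_zpow, ModularGroup.S, gamma1951]
  fin_cases i <;> fin_cases j <;> simp [Matrix.mul_apply, Fin.sum_univ_two]

/-- For a `P`-periodic `g`, `∫₀^P g(-x) dx = ∫₀^P g(x) dx` — no integrability needed. [folklore] -/
theorem integral_reflect_periodic (g : ℝ → ℂ) (P : ℝ) (hper : ∀ x, g (x + P) = g x) :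
    ∫ x in (0 : ℝ)..P, g (-x) = ∫ x in (0 : ℝ)..P, g x := by
  have e : (fun x => g x) = fun x => g (x - P) := by
    funext x; rw [← hper (x - P), sub_add_cancel]
  have h : ∫ x in (0 : ℝ)..P, g x = ∫ x in (-P : ℝ)..0, g x := by
    calc ∫ x in (0 : ℝ)..P, g x = ∫ x in (0 : ℝ)..P, g (x - P) := by rw [← e]
      _ = ∫ x in (0 : ℝ) - P..P - P, g x := intervalIntegral.integral_comp_sub_right _ P
      _ = ∫ x in (-P : ℝ)..0, g x := by simp
  rw [h, intervalIntegral.integral_comp_neg]; simp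

/-! ### Regularity: the Laplacian under `R`; continuity -/

/-- The reflection `w ↦ -w̄` of `ℂ` as a real-linear isometry. [folklore] -/
def reflLIE : ℂ ≃ₗᵢ[ℝ] ℂ := Complex.conjLIE.trans (LinearIsometryEquiv.neg ℝ)

/-- `reflLIE w = -w̄`. [folklore] -/
@[simp] theorem reflLIE_apply (w : ℂ) : reflLIE w = -conj w := by
  simp [reflLIE, LinearIsometryEquiv.trans_apply, LinearIsometryEquiv.coe_neg]

/-- The Euclidean Laplacian on `ℂ ≅ ℝ²` is invariant under real-linear isometries:
`Δ (f ∘ L) x = (Δ f) (L x)` (no differentiability hypothesis). [folklore] -/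
theorem laplacian_comp_linearIsometryEquiv (f : ℂ → ℂ) (L : ℂ ≃ₗᵢ[ℝ] ℂ) (x : ℂ) :
    (Δ (f ∘ L)) x = (Δ f) (L x) := by
  set v := Complex.orthonormalBasisOneI with hv
  have h1 := congrFun (InnerProductSpace.laplacian_eq_iteratedFDeriv_orthonormalBasis (f ∘ L) v) x
  have h2 := congrFun (InnerProductSpace.laplacian_eq_iteratedFDeriv_orthonormalBasis f (v.map L)) (L x)
  rw [h1, h2]
  refine Finset.sum_congr rfl fun i _ => ?_
  have h := L.toContinuousLinearEquiv.iteratedFDerivWithin_comp_right f uniqueDiffOn_univ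
    (Set.mem_univ (L.toContinuousLinearEquiv x)) 2
  simp only [Set.preimage_univ, iteratedFDerivWithin_univ,
    LinearIsometryEquiv.coe_toContinuousLinearEquiv] at h
  rw [h, ContinuousMultilinearMap.compContinuousLinearMap_apply, OrthonormalBasis.map_apply]
  congr 1
  funext j
  fin_cases j <;> simp

/-- On the open half-plane `(u ∘ R) ∘ ofComplex` agrees with `(u ∘ ofComplex) ∘ reflLIE`. [folklore] -/
theorem comp_J_ofComplex_eq (u : ℍ → ℂ) {w : ℂ} (hw : 0 < w.im) :
    ((fun z => u (J • z)) ∘ ofComplex) w = ((u ∘ ofComplex) ∘ reflLIE) w := by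
  simp only [Function.comp_apply, reflLIE_apply]
  rw [J_smul_ofComplex' w hw]

/-- `IsC2` and `hypLaplacian` transport under `R`: `Δ(u ∘ R) = (Δ u) ∘ R` (and `Im (R z) = Im z`). [folklore] -/
theorem reflect_laplacian (u : ℍ → ℂ) (hu : IsC2 u) :
    IsC2 (fun z => u (J • z)) ∧ ∀ z : ℍ, hypLaplacian (fun w => u (J • w)) z = hypLaplacian u (J • z) := by
  have hmaps : Set.MapsTo (reflLIE : ℂ → ℂ) {w : ℂ | 0 < w.im} {w : ℂ | 0 < w.im} := by
    intro w hw; simpa [reflLIE_apply] using hw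
  constructor
  · unfold IsC2 at hu ⊢
    exact (hu.comp reflLIE.contDiff.contDiffOn hmaps).congr fun w hw => comp_J_ofComplex_eq u hw
  · intro z
    unfold hypLaplacian
    rw [show (J • z).im = z.im by rw [← coe_im, coe_J_smul]; simp]
    congr 1
    have hev : ((fun w => u (J • w)) ∘ ofComplex) =ᶠ[nhds (z : ℂ)] ((u ∘ ofComplex) ∘ reflLIE) := by
      filter_upwards [isOpen_upperHalfPlaneSet.mem_nhds z.im_pos] with w hw
      exact comp_J_ofComplex_eq u hw
    rw [(InnerProductSpace.laplacian_congr_nhds hev).eq_of_nhds, laplacian_comp_linearIsometryEquiv,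
      reflLIE_apply, coe_J_smul]

/-- `C²` on the open half-plane gives `C²` at each point of `ℍ` (for the linearity of `Δ`). [folklore] -/
theorem contDiffAt_of_isC2 {u : ℍ → ℂ} (hu : IsC2 u) (z : ℍ) : ContDiffAt ℝ 2 (u ∘ ofComplex) (z : ℂ) :=
  hu.contDiffAt (isOpen_upperHalfPlaneSet.mem_nhds z.im_pos)

/-- `C²` functions on `ℍ` are continuous. [folklore] -/
theorem continuous_of_isC2 {u : ℍ → ℂ} (hu : IsC2 u) : Continuous u := by
  have h := hu.continuousOn.comp_continuous continuous_coe fun z => z.im_pos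
  simpa only [Function.comp_def, ofComplex_apply] using h

/-- The horizontal line `x ↦ x + iy` (`y > 0`) is a continuous path in `ℍ`. [folklore] -/
theorem continuous_horizontal (y : ℝ) (hy : 0 < y) : Continuous fun x : ℝ => ofComplex ((x : ℂ) + y * Complex.I) := by
  have him : ∀ x : ℝ, 0 < ((x : ℂ) + y * Complex.I).im := fun x => by simpa using hy
  have h : Continuous fun x : ℝ => UpperHalfPlane.mk ((x : ℂ) + y * Complex.I) (him x) :=
    Continuous.upperHalfPlaneMk (by fun_prop) him
  exact h.congr fun x => (ofComplex_apply_of_im_pos (him x)).symm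

/-- … and so is `x ↦ S • (x + iy)`. [folklore] -/
theorem continuous_horizontal_S (y : ℝ) (hy : 0 < y) :
    Continuous fun x : ℝ => ModularGroup.S • ofComplex ((x : ℂ) + y * Complex.I) :=
  (continuous_const_smul ((ModularGroup.S : SL(2, ℤ)) : GL (Fin 2) ℝ)).comp (continuous_horizontal y hy)

/-- Interval integrability of `x ↦ u (g x)` for continuous `u : ℍ → ℂ` and a continuous path `g`. [folklore] -/
theorem intervalIntegrable_comp {u : ℍ → ℂ} (hu : Continuous u) {g : ℝ → ℍ} (hg : Continuous g) (a b : ℝ) :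
    IntervalIntegrable (fun x => u (g x)) MeasureTheory.volume a b :=
  (hu.comp hg).intervalIntegrable a b

/-! ### The witness class: periodicity, stability under `R`, linearity; the Hecke operators -/

/-- Automorphy gives the period `1`: `u (w + 1) = u (w)` (`T ∈ Γ₀(1951)`, `χ(1) = 1`). [folklore] -/
theorem periodic_one {χ : DirichletCharacter ℂ 1951} {u : ℍ → ℂ}
    (haut : ∀ γ : SL(2, ℤ), γ ∈ CongruenceSubgroup.Gamma0 1951 → ∀ z : ℍ, u (γ • z) = χ ((γ 1 1 : ℤ) : ZMod 1951) * u z)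
    (w : ℂ) (hw : 0 < w.im) : u (ofComplex (w + 1)) = u (ofComplex w) := by
  have hT : ModularGroup.T ∈ CongruenceSubgroup.Gamma0 1951 := by
    rw [CongruenceSubgroup.Gamma0_mem]; simp [ModularGroup.T]
  have hT1 : ((ModularGroup.T 1 1 : ℤ) : ZMod 1951) = 1 := by simp [ModularGroup.T]
  rw [← T_smul_ofComplex' w hw, haut _ hT, hT1, map_one, one_mul]

/-- Automorphy gives the period `1951` after `S` (`S T^{1951} = [[1,0],[-1951,1]] S`). [folklore] -/
theorem periodic_S {χ : DirichletCharacter ℂ 1951} {u : ℍ → ℂ}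
    (haut : ∀ γ : SL(2, ℤ), γ ∈ CongruenceSubgroup.Gamma0 1951 → ∀ z : ℍ, u (γ • z) = χ ((γ 1 1 : ℤ) : ZMod 1951) * u z)
    (y : ℝ) (hy : 0 < y) (x : ℝ) :
    u (ModularGroup.S • ofComplex (((x + 1951 : ℝ)) + y * Complex.I)) =
      u (ModularGroup.S • ofComplex ((x : ℂ) + y * Complex.I)) := by
  have hγ : gamma1951 ∈ CongruenceSubgroup.Gamma0 1951 := by
    rw [CongruenceSubgroup.Gamma0_mem]; simp [gamma1951]; decide
  have hγ1 : ((gamma1951 1 1 : ℤ) : ZMod 1951) = 1 := by simp [gamma1951]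
  have e : ((x + 1951 : ℝ) : ℂ) = ((x + (1951 : ℤ) : ℝ) : ℂ) := by push_cast; ring
  rw [e, ← T_zpow_smul_ofComplex 1951 x y hy, ← mul_smul, S_mul_T_zpow, mul_smul, haut _ hγ, hγ1, map_one, one_mul]

/-- The witness class is stable under `u ↦ u ∘ R` (same `λ`, same character). [folklore] -/
theorem isForm_reflect {χ : DirichletCharacter ℂ 1951} {u : ℍ → ℂ} {lam : ℝ} (h : IsForm χ u lam) :
    IsForm χ (fun z => u (J • z)) lam := by
  obtain ⟨hC2, hΔ, haut, hct1, hct2, C, hC⟩ := h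
  obtain ⟨hC2J, hΔJ⟩ := reflect_laplacian u hC2
  refine ⟨hC2J, fun z => by rw [hΔJ]; exact hΔ (J • z), fun γ hγ z => ?_, fun y hy => ?_, fun y hy => ?_,
    C, fun z => hC _⟩
  · show u (J • γ • z) = _ * u (J • z)
    rw [J_smul_sl_smul, haut _ (reflConj_mem hγ)]
    rfl
  · have e : (fun x : ℝ => u (J • ofComplex ((x : ℂ) + y * Complex.I))) =
        fun x : ℝ => (fun t : ℝ => u (ofComplex ((t : ℂ) + y * Complex.I))) (-x) := by
      funext x; rw [J_smul_ofComplex x y hy]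
    have hper : ∀ x : ℝ, u (ofComplex (((x + 1 : ℝ) : ℂ) + y * Complex.I)) = u (ofComplex ((x : ℂ) + y * Complex.I)) :=
      fun x => by
        rw [show (((x + 1 : ℝ) : ℂ) + y * Complex.I) = ((x : ℂ) + y * Complex.I) + 1 by push_cast; ring,
          periodic_one haut _ (by simpa using hy)]
    show ∫ x in (0 : ℝ)..1, u (J • ofComplex ((x : ℂ) + y * Complex.I)) = 0
    rw [e, integral_reflect_periodic (fun t : ℝ => u (ofComplex ((t : ℂ) + y * Complex.I))) 1 hper, hct1 y hy]
  · have e : (fun x : ℝ => u (J • ModularGroup.S • ofComplex ((x : ℂ) + y * Complex.I))) =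
        fun x : ℝ => (fun t : ℝ => u (ModularGroup.S • ofComplex ((t : ℂ) + y * Complex.I))) (-x) := by
      funext x; rw [J_smul_S_smul, J_smul_ofComplex x y hy]
    show ∫ x in (0 : ℝ)..1951, u (J • ModularGroup.S • ofComplex ((x : ℂ) + y * Complex.I)) = 0
    rw [e, integral_reflect_periodic (fun t : ℝ => u (ModularGroup.S • ofComplex ((t : ℂ) + y * Complex.I))) 1951
      (periodic_S haut y hy), hct2 y hy]

/-- The witness class is a linear space: closed under `(u, v) ↦ u + c v`. [folklore] -/
theorem isForm_add_mul {χ : DirichletCharacter ℂ 1951} {u v : ℍ → ℂ} {lam : ℝ} (hu : IsForm χ u lam)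
    (hv : IsForm χ v lam) (c : ℂ) : IsForm χ (fun z => u z + c * v z) lam := by
  obtain ⟨huC, huΔ, hua, hu1, hu2, Cu, hCu⟩ := hu
  obtain ⟨hvC, hvΔ, hva, hv1, hv2, Cv, hCv⟩ := hv
  have hcu := continuous_of_isC2 huC
  have hcv := continuous_of_isC2 hvC
  refine ⟨?_, fun z => ?_, fun γ hγ z => ?_, fun y hy => ?_, fun y hy => ?_, Cu + ‖c‖ * Cv, fun z => ?_⟩
  · unfold IsC2 at huC hvC ⊢
    exact huC.add (contDiffOn_const.mul hvC)
  · unfold hypLaplacian at huΔ hvΔ ⊢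
    beta_reduce
    have h2 := contDiffAt_of_isC2 hvC z
    have h2c : ContDiffAt ℝ 2 (c • (v ∘ ofComplex)) (z : ℂ) := h2.const_smul c
    have e : ((fun w => u w + c * v w) ∘ ofComplex) = (u ∘ ofComplex) + c • (v ∘ ofComplex) := rfl
    rw [e, (contDiffAt_of_isC2 huC z).laplacian_add h2c, InnerProductSpace.laplacian_smul c h2, smul_eq_mul]
    linear_combination huΔ z + c * hvΔ z
  · show u (γ • z) + c * v (γ • z) = _ * (u z + c * v z)
    rw [hua γ hγ z, hva γ hγ z]; ring
  · have iu := intervalIntegrable_comp hcu (continuous_horizontal y hy) 0 1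
    have iv := (intervalIntegrable_comp hcv (continuous_horizontal y hy) 0 1).const_mul c
    beta_reduce
    rw [intervalIntegral.integral_add iu iv, intervalIntegral.integral_const_mul, hu1 y hy, hv1 y hy, mul_zero, add_zero]
  · have iu := intervalIntegrable_comp hcu (continuous_horizontal_S y hy) 0 1951
    have iv := (intervalIntegrable_comp hcv (continuous_horizontal_S y hy) 0 1951).const_mul c
    beta_reduce
    rw [intervalIntegral.integral_add iu iv, intervalIntegral.integral_const_mul, hu2 y hy, hv2 y hy, mul_zero, add_zero]
  · calc ‖u z + c * v z‖ ≤ ‖u z‖ + ‖c * v z‖ := norm_add_le _ _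
      _ ≤ Cu + ‖c‖ * Cv := by
        rw [norm_mul]; exact add_le_add (hCu z) (mul_le_mul_of_nonneg_left (hCv z) (norm_nonneg c))

/-- `T_p` is linear. [folklore] -/
theorem Tp_add_mul (χ : DirichletCharacter ℂ 1951) (p : ℕ) (u v : ℍ → ℂ) (c : ℂ) (z : ℍ) :
    Tp χ p (fun w => u w + c * v w) z = Tp χ p u z + c * Tp χ p v z := by
  unfold Tp
  rw [Finset.sum_add_distrib, ← Finset.mul_sum]
  ring

/-- `T_p` commutes with `R` on functions of period `1`: `-conj((z+b)/p) = (Rz - b)/p`, and the points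
`(w - b)/p`, `0 ≤ b < p`, are `(w + b')/p` (`b' = 0` for `b = 0`, `b' = p - b` otherwise) up to the period.
[folklore] -/
theorem Tp_reflect (χ : DirichletCharacter ℂ 1951) {p : ℕ} (hp0 : 0 < p) {u : ℍ → ℂ}
    (hperC : ∀ w : ℂ, 0 < w.im → u (ofComplex (w + 1)) = u (ofComplex w)) (z : ℍ) :
    Tp χ p (fun w => u (J • w)) z = Tp χ p u (J • z) := by
  have hpR : (0 : ℝ) < p := by exact_mod_cast hp0
  have hzim : 0 < (z : ℂ).im := z.im_pos
  unfold Tp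
  have h2 : J • ofComplex ((p : ℂ) * z) = ofComplex ((p : ℂ) * ↑(J • z)) := by
    have him : 0 < ((p : ℂ) * (z : ℂ)).im := by simpa using mul_pos hpR hzim
    rw [J_smul_ofComplex' _ him, coe_J_smul]
    congr 1
    simp [map_mul, map_natCast]
  have h1 : ∀ b ∈ Finset.range p,
      u (J • ofComplex (((z : ℂ) + b) / p)) = u (ofComplex (((↑(J • z) : ℂ) - b) / p)) := by
    intro b _
    have him : 0 < (((z : ℂ) + b) / p).im := by
      rw [Complex.div_natCast_im]; simpa using div_pos hzim hpR
    rw [J_smul_ofComplex' _ him, coe_J_smul]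
    congr 2
    simp only [map_div₀, map_add, map_natCast]
    ring
  have hJim : 0 < ((↑(J • z) : ℂ)).im := (J • z).im_pos
  -- shift `(w - b)/p ↦ (w + b')/p` using the period `1`
  have hshift : ∑ b ∈ Finset.range p, u (ofComplex (((↑(J • z) : ℂ) - b) / p)) =
      ∑ b ∈ Finset.range p, u (ofComplex (((↑(J • z) : ℂ) + b) / p)) := by
    set w : ℂ := ↑(J • z) with hw
    refine Finset.sum_nbij' (fun b => if b = 0 then 0 else p - b) (fun b => if b = 0 then 0 else p - b)
      ?_ ?_ ?_ ?_ ?_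
    · intro b hb; simp only [Finset.mem_range] at hb ⊢; split_ifs <;> omega
    · intro b hb; simp only [Finset.mem_range] at hb ⊢; split_ifs <;> omega
    · intro b hb; simp only [Finset.mem_range] at hb; split_ifs <;> omega
    · intro b hb; simp only [Finset.mem_range] at hb; split_ifs <;> omega
    · intro b hb
      simp only [Finset.mem_range] at hb
      by_cases h0 : b = 0
      · simp [h0]
      · simp only [h0, if_false]
        have hpC : (p : ℂ) ≠ 0 := by exact_mod_cast hp0.ne'
        have e : (w + ((p - b : ℕ) : ℂ)) / p = (w - b) / p + 1 := by
          rw [Nat.cast_sub hb.le]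
          field_simp
          ring
        have him : 0 < ((w - b) / p).im := by
          rw [Complex.div_natCast_im]; simpa using div_pos hJim hpR
        rw [e, hperC _ him]
  beta_reduce
  rw [Finset.sum_congr rfl h1, hshift, h2]

end ParityClosureAux

open ParityClosureAux in
/-- **Stub S1 `stub_parityClosure`** (registered signature of line `Sketch`, crux stmt-Langlands-15897): the
crux's witness class `IsForm χ · λ` is closed under `u ↦ u − u∘R` and `u ↦ u + u∘R` (`R z = -z̄`), and the odd
and even parts keep the `T_p`-eigenvalues of `u` at `p ∈ {2,3,5,7,11,13}`. -/
theorem stub_parityClosure : ParityClosure := by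
  intro χ u lam hform
  have hJ := isForm_reflect hform
  have esub : (fun z => u z - u (J • z)) = fun z => u z + (-1) * u (J • z) := by funext z; ring
  have eadd : (fun z => u z + u (J • z)) = fun z => u z + 1 * u (J • z) := by funext z; ring
  refine ⟨⟨by rw [esub]; exact isForm_add_mul hform hJ (-1), by rw [eadd]; exact isForm_add_mul hform hJ 1⟩,
    fun p hp μ hTu => ?_⟩
  have hp0 : 0 < p := by
    simp only [P₀, Finset.mem_insert, Finset.mem_singleton] at hp
    rcases hp with rfl | rfl | rfl | rfl | rfl | rfl <;> norm_num
  have hTJ : ∀ z, Tp χ p (fun w => u (J • w)) z = μ * u (J • z) := fun z => by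
    rw [Tp_reflect χ hp0 (periodic_one hform.2.2.1) z, hTu]
  constructor
  · intro z
    rw [esub, Tp_add_mul χ p u (fun w => u (J • w)) (-1) z, hTu, hTJ]; ring
  · intro z
    rw [eadd, Tp_add_mul χ p u (fun w => u (J • w)) 1 z, hTu, hTJ]; ring

end Summit.Langlands.Langlands.Theorems.QuarterFingerprintDeficit

end
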